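import Literature.AlgebraicGeometry.Resolution.SmoothUniformizationProofs
import Literature.AlgebraicGeometry.Resolution.FibreStalkDVR
import Literature.AlgebraicGeometry.Motives.FiberStalk
import Mathlib.AlgebraicGeometry.Morphisms.Smooth
import Mathlib.LinearAlgebra.Basis.VectorSpace
import HarnessLib

/-!
# Cotangent classes ascend along flat local homomorphisms with regular closed fibre

Topic: `Literature/AlgebraicGeometry/Resolution`. A brick for transporting "part of a regular system of
parameters" (linear independence of classes in `𝔪/𝔪²`) along SMOOTH morphisms at ARBITRARY points — no hypothesis
on residue fields or on a ground field (the tree's formally-smooth route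
`Summits/…/WeightedInvariantWeightedConstructionPlexComapStalk.lean` needs `κ(f x)` formally smooth over `k`, i.e.
closed points over a perfect field). The statement is the injectivity `κ(S) ⊗_{κ(R)} 𝔪/𝔪² ↪ 𝔫/𝔫²` hidden in the
proof of Matsumura's Thm. 23.7 (ii) (`emb dim S = emb dim R + emb dim S/𝔪S` for a flat local homomorphism with
regular closed fibre — the tree's `spanFinrank_maximalIdeal_eq_add`, `SmoothUniformizationProofs.lean` §FlatLocal).

* `linearIndependent_toCotangent_map_of_flat_of_isRegularLocalRing_fibre` — for a local homomorphism
  `(R, 𝔪) → (S, 𝔫)` of Noetherian local rings with `S` flat over `R` and `S/𝔪S` regular: `κ(R)`-independent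
  classes of `u₁, …, u_m ∈ 𝔪` in `𝔪/𝔪²` map to `κ(S)`-independent classes in `𝔫/𝔫²` (no regularity of `R`).
  Proof: in a minimal basis `x` of `𝔪`, a relation `Σ cᵢ uᵢ ∈ 𝔫²` gives `Σⱼ dⱼ xⱼ ∈ 𝔪S ∩ 𝔫² ⊆ 𝔪𝔫`
  (`map_maximalIdeal_inf_sq_le_mul`) so `dⱼ ∈ 𝔫` (`mem_maximalIdeal_of_sum_mul_mem_map_mul`, flatness); a
  `κ(R)`-linear functional with `ūᵢ ↦ δᵢₖ` (`LinearMap.exists_extend` of `LinearIndependent.repr`), lifted to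
  `R`, turns this into `cₖ ∈ 𝔫`.
* `linearIndependent_toCotangent_stalkMap_of_flat_of_isRegularLocalRing_fiber` — stalk form along a flat
  morphism of locally Noetherian schemes at a point with regular fibre ring `𝒪_{X,x}/𝔪_{f x}𝒪_{X,x}`;
* `linearIndependent_toCotangent_stalkMap_of_smooth'` — along a smooth morphism with locally Noetherian target,
  at every point (fibres of smooth morphisms have regular local rings, `isRegularLocalRing_stalk_fiber_of_mem_smoothLocus`).

## Sources

* H. Matsumura, *Commutative Ring Theory*, CUP 1986, Thm. 23.7 (book p. 183) and its proof. [Matsumura1987]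
* A. Grothendieck, J. Dieudonné, EGA IV₄ (1967), 17.5.8 (smooth ⇒ flat with regular fibres).
-/

noncomputable section

namespace Literature.AlgebraicGeometry.Resolution

universe u

open IsLocalRing CategoryTheory
open _root_.AlgebraicGeometry

/-! ## Local algebra -/

section FlatLocal

variable {R S : Type u} [CommRing R] [CommRing S] [IsLocalRing R] [IsNoetherianRing R]
  [IsLocalRing S] [IsNoetherianRing S] [Algebra R S] [IsLocalHom (algebraMap R S)]
  [Module.Flat R S]

/-- **Cotangent classes ascend along a flat local homomorphism with regular closed fibre.** Let
`(R, 𝔪) → (S, 𝔫)` be a local homomorphism of Noetherian local rings with `S` flat over `R` and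
`S/𝔪S` a regular local ring (no hypothesis on `R` or on the residue fields). If `u₁, …, u_m ∈ 𝔪`
have `κ(R)`-linearly independent classes in `𝔪/𝔪²`, their images have `κ(S)`-linearly independent
classes in `𝔫/𝔫²` — i.e. `κ(S) ⊗ 𝔪/𝔪² → 𝔫/𝔫²` is injective. Proof: write `uᵢ = Σⱼ aᵢⱼ xⱼ` in a
minimal basis `x` of `𝔪`; a relation `Σ cᵢ uᵢ ∈ 𝔫²` gives `Σⱼ dⱼ xⱼ ∈ 𝔪S ∩ 𝔫² ⊆ 𝔪𝔫`
(`map_maximalIdeal_inf_sq_le_mul`, regular fibre) hence `dⱼ = Σᵢ cᵢ aᵢⱼ ∈ 𝔫` (flatness,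
`mem_maximalIdeal_of_sum_mul_mem_map_mul`); a `κ(R)`-linear functional with `ūᵢ ↦ δᵢₖ`, lifted to
`R`, turns this into `cₖ ∈ 𝔫`. [cite: Matsumura1987, Thm. 23.7 (book p. 183), proof] -/
theorem linearIndependent_toCotangent_map_of_flat_of_isRegularLocalRing_fibre
    [IsRegularLocalRing (S ⧸ (maximalIdeal R).map (algebraMap R S))]
    {ι : Type*} [Fintype ι] (u : ι → R) (hu : ∀ i, u i ∈ maximalIdeal R)
    (hli : LinearIndependent (ResidueField R) fun i => (maximalIdeal R).toCotangent ⟨u i, hu i⟩) :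
    LinearIndependent (ResidueField S) fun i =>
      (maximalIdeal S).toCotangent
        ⟨algebraMap R S (u i), map_nonunit (algebraMap R S) (u i) (hu i)⟩ := by
  classical
  set φ := algebraMap R S with hφ
  -- (a) a minimal basis `x` of `𝔪_R` and coordinates `a i j` of the `u i`
  obtain ⟨x, hx⟩ := exists_minimalBasis_maximalIdeal (R := R)
  have hxm : ∀ j, x j ∈ maximalIdeal R := fun j => hx ▸ Ideal.subset_span ⟨j, rfl⟩
  have hex : ∀ i, ∃ a : Fin (maximalIdeal R).spanFinrank → R, ∑ j, a j * x j = u i := fun i =>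
    Ideal.mem_span_range_iff_exists_fun.mp (hx.symm ▸ hu i)
  choose a ha using hex
  -- (b) a functional `g` on `𝔪/𝔪²` with `g (ū i) = single i 1`, and lifts `b j k` of `g (x̄ j) k`
  obtain ⟨g, hg⟩ := LinearMap.exists_extend hli.repr
  have hgu : ∀ i k, g ((maximalIdeal R).toCotangent ⟨u i, hu i⟩) k = if i = k then 1 else 0 := by
    intro i k
    have hmem : (maximalIdeal R).toCotangent ⟨u i, hu i⟩ ∈ Submodule.span (ResidueField R)
        (Set.range fun i => (maximalIdeal R).toCotangent ⟨u i, hu i⟩) :=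
      Submodule.subset_span ⟨i, rfl⟩
    have h1 : g ((maximalIdeal R).toCotangent ⟨u i, hu i⟩) = hli.repr ⟨_, hmem⟩ := by
      rw [← hg]; rfl
    rw [h1, hli.repr_eq_single i ⟨_, hmem⟩ rfl, Finsupp.single_apply]
  have hbex : ∀ j k, ∃ b : R, residue R b = g ((maximalIdeal R).toCotangent ⟨x j, hxm j⟩) k :=
    fun j k => residue_surjective _
  choose b hb using hbex
  -- (c) `ū i = Σ_j (a i j) • x̄ j`, hence `Σ_j a i j * b j k ≡ δ_ik (mod 𝔪)`
  have hcot : ∀ i, (maximalIdeal R).toCotangent ⟨u i, hu i⟩ =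
      ∑ j, residue R (a i j) • (maximalIdeal R).toCotangent ⟨x j, hxm j⟩ := by
    intro i
    have : (⟨u i, hu i⟩ : maximalIdeal R) =
        ∑ j, a i j • (⟨x j, hxm j⟩ : maximalIdeal R) := by
      apply Subtype.ext
      simp [ha i]
    rw [this, map_sum]
    refine Finset.sum_congr rfl fun j _ => ?_
    rw [LinearMap.map_smul_of_tower]
    exact (algebraMap_smul (ResidueField R) (a i j) _).symm
  have he : ∀ i k, (∑ j, a i j * b j k) - (if i = k then 1 else 0) ∈ maximalIdeal R := by
    intro i k
    rw [← residue_eq_zero_iff, map_sub, map_sum]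
    simp_rw [map_mul, hb]
    have : ∑ j, residue R (a i j) * g ((maximalIdeal R).toCotangent ⟨x j, hxm j⟩) k =
        g ((maximalIdeal R).toCotangent ⟨u i, hu i⟩) k := by
      rw [hcot i, map_sum, Finsupp.finsetSum_apply]
      refine Finset.sum_congr rfl fun j _ => ?_
      rw [map_smul, Finsupp.smul_apply, smul_eq_mul]
    rw [this, hgu]
    split_ifs <;> simp
  -- (d) the ring-level criterion
  refine linearIndependent_toCotangent_of_forall_sum _ _ fun c hc => ?_
  set d : Fin (maximalIdeal R).spanFinrank → S := fun j => ∑ i, c i * φ (a i j) with hd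
  have hsum : ∑ j, d j * φ (x j) = ∑ i, c i * φ (u i) := by
    simp only [hd, Finset.sum_mul]
    rw [Finset.sum_comm]
    refine Finset.sum_congr rfl fun i _ => ?_
    rw [← ha i, map_sum, Finset.mul_sum]
    refine Finset.sum_congr rfl fun j _ => ?_
    rw [map_mul]
    ring
  have hdn : ∀ j, d j ∈ maximalIdeal S := by
    have hmem : ∑ j, d j * φ (x j) ∈
        (maximalIdeal R).map (algebraMap R S) ⊓ (maximalIdeal S) ^ 2 := by
      refine ⟨Ideal.sum_mem _ fun j _ => Ideal.mul_mem_left _ _ (Ideal.mem_map_of_mem _ (hxm j)),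
        ?_⟩
      rw [hsum]
      exact hc
    exact mem_maximalIdeal_of_sum_mul_mem_map_mul rfl x hx d (map_maximalIdeal_inf_sq_le_mul hmem)
  -- (e) `c k = Σ_j d j * φ (b j k) - Σ_i c i * φ (e i k)`
  intro k
  have h1 : ∑ j, d j * φ (b j k) = ∑ i, c i * φ (∑ j, a i j * b j k) := by
    simp only [hd, Finset.sum_mul]
    rw [Finset.sum_comm]
    refine Finset.sum_congr rfl fun i _ => ?_
    rw [map_sum, Finset.mul_sum]
    refine Finset.sum_congr rfl fun j _ => ?_
    rw [map_mul]
    ring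
  have h2 : ∑ i, c i * φ (if i = k then 1 else 0) = c k := by
    simp_rw [apply_ite φ, map_one, map_zero, mul_ite, mul_one, mul_zero]
    rw [Finset.sum_ite_eq' Finset.univ k c]
    simp
  have hck : c k = ∑ j, d j * φ (b j k) -
      ∑ i, c i * φ ((∑ j, a i j * b j k) - (if i = k then 1 else 0)) := by
    rw [h1, ← Finset.sum_sub_distrib]
    simp_rw [map_sub, mul_sub, sub_sub_cancel]
    exact h2.symm
  rw [hck]
  exact sub_mem (Ideal.sum_mem _ fun j _ => Ideal.mul_mem_right _ _ (hdn j))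
    (Ideal.sum_mem _ fun i _ => Ideal.mul_mem_left _ _ (map_nonunit φ _ (he i k)))

end FlatLocal

/-! ## Stalk forms -/

section Stalk

variable {X Y : Scheme.{u}}

/-- **Part of a regular system of parameters ascends along a flat morphism with regular fibre (stalk
form).** For `f : X → Y` flat between locally Noetherian schemes and a point `x` at which the local
ring `𝒪_{X,x}/𝔪_{f x}𝒪_{X,x}` of the fibre is regular: if `v₁, …, v_m ∈ 𝔪_{Y, f x}` have
`κ(f x)`-linearly independent classes in `𝔪/𝔪²`, the `f^* vᵢ ∈ 𝔪_{X, x}` have `κ(x)`-linearly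
independent classes in `𝔪/𝔪²`. No hypothesis on the residue fields (compare
`linearIndependent_toCotangent_stalkMap_of_smooth`, which needs `κ(f x)` formally smooth over the
ground field). [cite: Matsumura1987, Thm. 23.7 (book p. 183), proof] -/
theorem linearIndependent_toCotangent_stalkMap_of_flat_of_isRegularLocalRing_fiber
    [IsLocallyNoetherian X] [IsLocallyNoetherian Y] (f : X ⟶ Y) [Flat f] (x : X)
    (hreg : IsRegularLocalRing
      (X.presheaf.stalk x ⧸ (maximalIdeal (Y.presheaf.stalk (f x))).map (f.stalkMap x).hom))
    {ι : Type*} [Fintype ι] (v : ι → Y.presheaf.stalk (f x))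
    (hv : ∀ i, v i ∈ maximalIdeal (Y.presheaf.stalk (f x)))
    (hli : LinearIndependent (ResidueField (Y.presheaf.stalk (f x)))
      fun i => (maximalIdeal (Y.presheaf.stalk (f x))).toCotangent ⟨v i, hv i⟩) :
    LinearIndependent (ResidueField (X.presheaf.stalk x)) fun i =>
      (maximalIdeal (X.presheaf.stalk x)).toCotangent
        ⟨(f.stalkMap x).hom (v i), map_nonunit (f.stalkMap x).hom (v i) (hv i)⟩ := by
  letI := (f.stalkMap x).hom.toAlgebra
  haveI : Module.Flat (Y.presheaf.stalk (f x)) (X.presheaf.stalk x) := Flat.stalkMap f x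
  haveI : IsLocalHom (algebraMap (Y.presheaf.stalk (f x)) (X.presheaf.stalk x)) :=
    inferInstanceAs (IsLocalHom (f.stalkMap x).hom)
  haveI : IsRegularLocalRing (X.presheaf.stalk x ⧸
      (maximalIdeal (Y.presheaf.stalk (f x))).map
        (algebraMap (Y.presheaf.stalk (f x)) (X.presheaf.stalk x))) := hreg
  exact linearIndependent_toCotangent_map_of_flat_of_isRegularLocalRing_fibre v hv hli

/-- **Part of a regular system of parameters ascends along a SMOOTH morphism (stalk form, no
residue-field hypothesis).** For `f : X → Y` smooth with `Y` locally Noetherian and any point `x`: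
`κ(f x)`-independent cotangent classes of `v₁, …, v_m ∈ 𝔪_{Y, f x}` give `κ(x)`-independent
cotangent classes of the `f^* vᵢ` — a smooth morphism is flat and the local rings of its fibres are
regular (`isRegularLocalRing_stalk_fiber_of_mem_smoothLocus`). [cite: Matsumura1987, Thm. 23.7 (book p. 183), proof] -/
theorem linearIndependent_toCotangent_stalkMap_of_smooth' [IsLocallyNoetherian Y] (f : X ⟶ Y)
    [Smooth f] (x : X) {ι : Type*} [Fintype ι] (v : ι → Y.presheaf.stalk (f x))
    (hv : ∀ i, v i ∈ maximalIdeal (Y.presheaf.stalk (f x)))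
    (hli : LinearIndependent (ResidueField (Y.presheaf.stalk (f x)))
      fun i => (maximalIdeal (Y.presheaf.stalk (f x))).toCotangent ⟨v i, hv i⟩) :
    LinearIndependent (ResidueField (X.presheaf.stalk x)) fun i =>
      (maximalIdeal (X.presheaf.stalk x)).toCotangent
        ⟨(f.stalkMap x).hom (v i), map_nonunit (f.stalkMap x).hom (v i) (hv i)⟩ := by
  haveI : IsLocallyNoetherian X := LocallyOfFiniteType.isLocallyNoetherian f
  have hx : x ∈ f.smoothLocus := by
    rw [Scheme.Hom.smoothLocus_eq_top_iff.mpr ‹Smooth f›]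
    trivial
  have hfib := isRegularLocalRing_stalk_fiber_of_mem_smoothLocus f hx
  obtain ⟨e⟩ := Literature.AlgebraicGeometry.Motives.nonempty_stalkFiber_ringEquiv_asFiber f x
  haveI := hfib
  exact linearIndependent_toCotangent_stalkMap_of_flat_of_isRegularLocalRing_fiber f x
    (IsRegularLocalRing.of_ringEquiv e) v hv hli

end Stalk

end Literature.AlgebraicGeometry.Resolution

end
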